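import Summits.QuantumFields.YangMills.Theorems.BalabanUVNodesN08CoarseGrainingFarFresh

/-!
# BalabanUVNodes ∕ N08 — THE TRANSPORTED DENSITY DOES NOT DEPEND ON THE FAR COARSE VARIABLES: `T_Φ ρ =ᵐ A_Far(T_Φ ρ)` for every coarse-graining `Φ` axial on `Far` and
# near-local off `Far` (with `AvgAC Φ`), in particular `T^{axial}ρ =ᵐ A_Far(T^{axial}ρ)` — the a.e. (density) form of files 36∕36b's far-average identity, by self-adjointness
# of the far-average and uniqueness of renormalization images

Track A, DAG node N08 = T. Bałaban, CMP **102** (1985) 255–275 [Balaban1985UV3]: (2) p. 256, (10) p. 258, (48)–(49) p. 268; [Balaban1985Averaging] (15) p. 19; [Balaban1987RG1] (0.4)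
p. 253.  Cell `pub-ymgap`, width seat `pub-ymgap-dag-n08-w1` (g6), W-SEAT-START-LIST §n08 item 1 successor piece (o29) = file 37; `--supports` K1⁹ `StabilityBRunRowsAtRecordR13SepCoPHV`
(stmt-QuantumFields-27364, KEY MAP v2; helper).  Companion of files 36 (`…N08AxialDecimationFarFresh`) and 36b (`…N08CoarseGrainingFarFresh`).

WHAT THIS FILE PROVES (kernel; theorems only, 0 def; [folklore] measure theory; nothing of the papers asserted).  `A_Far h (V) := ∫ h(V↾Farᶜ ⊔ v) dHaar^{Far}(v)` written inline.
* `integral_mul_farAvg_comm` — for `g` integrable and `f` bounded measurable on the coarse fields: `A_Far g` is integrable and `∫ g·(A_Far f) dV = ∫ (A_Far g)·f dV` (Fubini over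
  pub-balaban3d's coarse splitting `FibreSplit`).
* ★★★ `rnTransport_ae_eq_farAvg_of_coarseGraining` — **`T_Φ ρ =ᵐ A_Far(T_Φ ρ)`** for every measurable `Φ` with `AvgAC Φ`, `Φ = axial` on `Far`, near-local off `Far`, and every
  integrable ρ not depending on the far-selected bonds; ★★★ `rnTransport_axial_ae_eq_farAvg` — the axial instance.  File 35's `T^{axial}ρ = ∫ρ` is `Far = ⊤`.

LOCATED READING (R4¹³ (G2), count-neutral; n08-w3∕w6 ∕ owners decide): the locality half of the cluster bookkeeping for road (ii) holds in the kernel for EVERY coarse-graining that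
is axial away from a guarded set — the shape of the maps `Ū_A` in the positivity expansion `μ∘Ū⁻¹ ≤ Σ_A (μ↾G_A)∘Ū_A⁻¹` of `N08-NO-STACKING-MECHANISM.md` §3; what is left there is
(G1) the local DENSITY bound of `(μ↾G_A)∘Ū_A⁻¹` near `A` (the Jacobian of the exp-mean-log correction: n08-w3∕w6's currency) and (G3) the summation over `A`.

HONEST FRAMING: count-neutral helper; (a)′ ∕ (F) ∕ E6′ NOT decided; `PrintedUV3V` NOT proved; N08 NOT discharged; one finite 𝕋⁴ programme at fixed ε, Bałaban AS PRINTED — R4 closes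
the conditional finite-𝕋⁴ rung `BalabanLadder.UV` only; the Yang–Mills mass gap (Clay) is NOT proved by any of this; nothing continuum ∕ ℝ⁴ ∕ OS.  No `sorry`, standard axioms.
-/

noncomputable section

open MeasureTheory
open scoped ENNReal

namespace Summit.QuantumFields.YangMills.BalabanUVNodes.N08AxialTransportFarIndependent

open Literature.MathematicalPhysics.QuantumFieldTheory.Balaban1983to89
open Literature.MathematicalPhysics.QuantumFieldTheory.Balaban1983to89.AveragingRT
open Summit.QuantumFields.Balaban3D.Proofs
open Summit.QuantumFields.Balaban3D.Carriers
open Summit.QuantumFields.BalabanUV.T4Continuum.Spine.NE7 (line_inj)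

/-! ## The transported density does not depend on the far coarse variables -/
section AE

variable {P : Params} {j : ℕ} {G : Type} [GaugeGroup G] [MeasurableSpace G] [HaarData G] [MeasurableMul₂ G]

omit [MeasurableMul₂ G] in
/-- **The far-average is self-adjoint against `dV`**: for `g` integrable and `f` bounded measurable on the coarse fields, `∫ g·(A_Far f) dV = ∫ (A_Far g)·f dV`, and `A_Far g` is
integrable (Fubini over the coarse splitting). [folklore] -/
theorem integral_mul_farAvg_comm (Far : PBond P (j + 1) → Prop) [DecidablePred Far]
    (g : GaugeField P (j + 1) G → ℝ) (hg : Integrable g (fieldMeasure P (j + 1) G))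
    (f : GaugeField P (j + 1) G → ℝ) (hf : Measurable f) (C : ℝ) (hC : ∀ V, |f V| ≤ C) :
    Integrable (fun V => ∫ v, g ((FibreSplit.splitEquiv Far (P := P) (G := G)).symm ((FibreSplit.splitEquiv Far (P := P) (G := G) V).1, v))
        ∂(Measure.pi fun _ : {c : PBond P (j + 1) // ¬¬ Far c} => (HaarData.haar : Measure G))) (fieldMeasure P (j + 1) G) ∧
    ∫ V, g V * (∫ v, f ((FibreSplit.splitEquiv Far (P := P) (G := G)).symm ((FibreSplit.splitEquiv Far (P := P) (G := G) V).1, v))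
        ∂(Measure.pi fun _ : {c : PBond P (j + 1) // ¬¬ Far c} => (HaarData.haar : Measure G))) ∂(fieldMeasure P (j + 1) G) =
      ∫ V, (∫ v, g ((FibreSplit.splitEquiv Far (P := P) (G := G)).symm ((FibreSplit.splitEquiv Far (P := P) (G := G) V).1, v))
        ∂(Measure.pi fun _ : {c : PBond P (j + 1) // ¬¬ Far c} => (HaarData.haar : Measure G))) * f V ∂(fieldMeasure P (j + 1) G) := by
  -- notation
  set μZ : Measure ({c : PBond P (j + 1) // ¬ Far c} → G) := Measure.pi fun _ => (HaarData.haar : Measure G) with hμZ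
  set μB : Measure ({c : PBond P (j + 1) // ¬¬ Far c} → G) := Measure.pi fun _ => (HaarData.haar : Measure G) with hμB
  set J := (FibreSplit.splitEquiv Far (P := P) (G := G)).symm with hJdef
  haveI : IsProbabilityMeasure μZ := by rw [hμZ]; exact Measure.pi.instIsProbabilityMeasure _
  haveI : IsProbabilityMeasure μB := by rw [hμB]; exact Measure.pi.instIsProbabilityMeasure _
  have hsplit := FibreSplit.measurePreserving_split Far (P := P) (G := G)
  have hJmp : MeasurePreserving J (μZ.prod μB) (fieldMeasure P (j + 1) G) := hsplit.symm _
  have hfst : ∀ V : GaugeField P (j + 1) G, (FibreSplit.splitEquiv Far (P := P) (G := G) V).1 = ((FibreSplit.splitEquiv Far (P := P) (G := G)) V).1 := fun _ => rfl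
  -- the inner averages as functions of the `¬Far` part
  set hgZ : ({c : PBond P (j + 1) // ¬ Far c} → G) → ℝ := fun x => ∫ v, g (J (x, v)) ∂μB with hhgZ
  set hfZ : ({c : PBond P (j + 1) // ¬ Far c} → G) → ℝ := fun x => ∫ v, f (J (x, v)) ∂μB with hhfZ
  have hgJ : Integrable (fun p : ({c : PBond P (j + 1) // ¬ Far c} → G) × ({c : PBond P (j + 1) // ¬¬ Far c} → G) => g (J p)) (μZ.prod μB) :=
    (hJmp.integrable_comp hg.aestronglyMeasurable).mpr hg
  have hgZ_int : Integrable hgZ μZ := hgJ.integral_prod_left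
  have hfZ_meas : Measurable hfZ := ((hf.comp J.measurable).stronglyMeasurable.integral_prod_right').measurable
  have hfZ_bdd : ∀ x, |hfZ x| ≤ C := by
    intro x
    refine (abs_integral_le_integral_abs).trans ?_
    calc ∫ v, |f (J (x, v))| ∂μB ≤ ∫ _v, C ∂μB :=
          integral_mono_of_nonneg (Filter.Eventually.of_forall fun _ => abs_nonneg _) (integrable_const C) (Filter.Eventually.of_forall fun _ => hC _)
      _ = C := by rw [integral_const, probReal_univ, one_smul]
  -- `A g = hgZ ∘ fst ∘ split`, `A f = hfZ ∘ fst ∘ split`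
  have hπ : MeasurePreserving (fun V : GaugeField P (j + 1) G => ((FibreSplit.splitEquiv Far (P := P) (G := G)) V).1) (fieldMeasure P (j + 1) G) μZ :=
    (measurePreserving_fst (μ := μZ) (ν := μB)).comp hsplit
  have hAg_int : Integrable (fun V => hgZ (((FibreSplit.splitEquiv Far (P := P) (G := G)) V).1)) (fieldMeasure P (j + 1) G) :=
    (hπ.integrable_comp hgZ_int.aestronglyMeasurable).mpr hgZ_int
  refine ⟨hAg_int, ?_⟩
  -- both sides as iterated integrals
  have hL : Integrable (fun V => g V * hfZ (((FibreSplit.splitEquiv Far (P := P) (G := G)) V).1)) (fieldMeasure P (j + 1) G) :=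
    hg.mul_bdd ((hfZ_meas.comp hπ.measurable).aestronglyMeasurable) (Filter.Eventually.of_forall fun V => by rw [Real.norm_eq_abs]; exact hfZ_bdd _)
  have hR : Integrable (fun V => hgZ (((FibreSplit.splitEquiv Far (P := P) (G := G)) V).1) * f V) (fieldMeasure P (j + 1) G) :=
    hAg_int.mul_bdd hf.aestronglyMeasurable (Filter.Eventually.of_forall fun V => by rw [Real.norm_eq_abs]; exact hC _)
  show ∫ V, g V * hfZ (((FibreSplit.splitEquiv Far (P := P) (G := G)) V).1) ∂_ = ∫ V, hgZ (((FibreSplit.splitEquiv Far (P := P) (G := G)) V).1) * f V ∂_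
  rw [FibreSplit.integral_fieldMeasure_split Far _ hL, FibreSplit.integral_fieldMeasure_split Far _ hR]
  refine integral_congr_ae (Filter.Eventually.of_forall fun x => ?_)
  have hxv : ∀ v, ((FibreSplit.splitEquiv Far (P := P) (G := G)) (J (x, v))).1 = x := fun v => by
    rw [hJdef, MeasurableEquiv.apply_symm_apply]
  show ∫ v, g (J (x, v)) * hfZ (((FibreSplit.splitEquiv Far (P := P) (G := G)) (J (x, v))).1) ∂μB =
    ∫ v, hgZ (((FibreSplit.splitEquiv Far (P := P) (G := G)) (J (x, v))).1) * f (J (x, v)) ∂μB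
  simp_rw [hxv]
  rw [integral_mul_const, integral_const_mul]

/-- ★★★ **THE TRANSPORTED DENSITY DOES NOT DEPEND ON THE FAR COARSE VARIABLES — for every coarse-graining `Φ` axial on `Far`, near-local off `Far`, with `AvgAC Φ`**: for ρ
integrable not depending on the far-selected bonds, `T_Φ ρ =ᵐ A_Far(T_Φ ρ)` — the Radon–Nikodym transport along `Φ` is a.e. a function of the NEAR coarse variables only (file 36b's
far-average identity + self-adjointness + uniqueness of renormalization images `RTAlgebra.IsRT.ae_eq`). [cite: Balaban1985UV3, (10) p.258 + (48)–(49) p.268 (bookkeeping); Balaban1985Averaging, (15) p.19; Balaban1987RG1, (0.4) p.253] -/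
theorem rnTransport_ae_eq_farAvg_of_coarseGraining (hj : j + 1 ≤ P.m + P.K) (Far : PBond P (j + 1) → Prop) [DecidablePred Far] (τ : PBond P (j + 1) → ℕ)
    (hτ : ∀ c, Far c → τ c < P.L) [DecidablePred fun b : PBond P j => ∃ c, Far c ∧ line c (τ c) = b]
    (Φ : GaugeField P j G → GaugeField P (j + 1) G) (hΦac : AvgAC Φ) (hΦfar : ∀ U c, Far c → Φ U c = axialAvg U c)
    (hΦnear : ∀ U U' : GaugeField P j G, (∀ b, (¬ ∃ c, Far c ∧ line c (τ c) = b) → U b = U' b) → ∀ c, ¬ Far c → Φ U c = Φ U' c)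
    (ρ : Density P j G) (hρ : Integrable ρ (fieldMeasure P j G))
    (hloc : ∀ W W' : GaugeField P j G, (∀ b, (¬ ∃ c, Far c ∧ line c (τ c) = b) → W b = W' b) → ρ W = ρ W') :
    rnTransport Φ ρ =ᵐ[fieldMeasure P (j + 1) G]
      fun V => ∫ v, rnTransport Φ ρ
        ((FibreSplit.splitEquiv Far (P := P) (G := G)).symm ((FibreSplit.splitEquiv Far (P := P) (G := G) V).1, v))
        ∂(Measure.pi fun _ : {c : PBond P (j + 1) // ¬¬ Far c} => (HaarData.haar : Measure G)) := by
  have hT : IsRT Φ ρ (rnTransport Φ ρ) := isRT_rnTransport_of_ac hΦac ρ hρ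
  have hTi : Integrable (rnTransport Φ ρ) (fieldMeasure P (j + 1) G) := integrable_rnTransport _ ρ hρ
  -- the far-average of `Tρ` is a renormalization image of `ρ`
  have hA : IsRT Φ ρ fun V => ∫ v, rnTransport Φ ρ
      ((FibreSplit.splitEquiv Far (P := P) (G := G)).symm ((FibreSplit.splitEquiv Far (P := P) (G := G) V).1, v))
      ∂(Measure.pi fun _ : {c : PBond P (j + 1) // ¬¬ Far c} => (HaarData.haar : Measure G)) := by
    intro f hf hfC
    obtain ⟨C, hC⟩ := hfC
    obtain ⟨-, hcomm⟩ := integral_mul_farAvg_comm Far _ hTi f hf C hC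
    rw [← hcomm]
    -- `∫ Tρ · (A f) dV = ∫ ρ · (A f)(Ū) dU = ∫ ρ · f(Ū) dU`
    obtain ⟨hAi, -⟩ := integral_mul_farAvg_comm Far f (integrable_of_abs_le hf C hC) f hf C hC
    have hAf_meas : Measurable fun V : GaugeField P (j + 1) G => ∫ v, f ((FibreSplit.splitEquiv Far (P := P) (G := G)).symm
        ((FibreSplit.splitEquiv Far (P := P) (G := G) V).1, v)) ∂(Measure.pi fun _ : {c : PBond P (j + 1) // ¬¬ Far c} => (HaarData.haar : Measure G)) := by
      have h1 : StronglyMeasurable fun x : {c : PBond P (j + 1) // ¬ Far c} → G =>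
          ∫ v, f ((FibreSplit.splitEquiv Far (P := P) (G := G)).symm (x, v)) ∂(Measure.pi fun _ : {c : PBond P (j + 1) // ¬¬ Far c} => (HaarData.haar : Measure G)) :=
        (hf.comp (FibreSplit.splitEquiv Far (P := P) (G := G)).symm.measurable).stronglyMeasurable.integral_prod_right'
      exact h1.measurable.comp (measurable_fst.comp (FibreSplit.splitEquiv Far (P := P) (G := G)).measurable)
    have hAf_bdd : ∀ V : GaugeField P (j + 1) G, |∫ v, f ((FibreSplit.splitEquiv Far (P := P) (G := G)).symm
        ((FibreSplit.splitEquiv Far (P := P) (G := G) V).1, v)) ∂(Measure.pi fun _ : {c : PBond P (j + 1) // ¬¬ Far c} => (HaarData.haar : Measure G))| ≤ C := by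
      intro V
      haveI : IsProbabilityMeasure (Measure.pi fun _ : {c : PBond P (j + 1) // ¬¬ Far c} => (HaarData.haar : Measure G)) :=
        Measure.pi.instIsProbabilityMeasure _
      refine (abs_integral_le_integral_abs).trans ?_
      calc ∫ v, |f ((FibreSplit.splitEquiv Far (P := P) (G := G)).symm ((FibreSplit.splitEquiv Far (P := P) (G := G) V).1, v))|
            ∂(Measure.pi fun _ : {c : PBond P (j + 1) // ¬¬ Far c} => (HaarData.haar : Measure G))
          ≤ ∫ _v, C ∂(Measure.pi fun _ : {c : PBond P (j + 1) // ¬¬ Far c} => (HaarData.haar : Measure G)) :=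
            integral_mono_of_nonneg (Filter.Eventually.of_forall fun _ => abs_nonneg _) (integrable_const C) (Filter.Eventually.of_forall fun _ => hC _)
        _ = C := by rw [integral_const, probReal_univ, one_smul]
    rw [hT _ hAf_meas ⟨C, hAf_bdd⟩]
    exact (N08CoarseGrainingFarFresh.integral_mul_comp_eq_farAvg_of_coarseGraining hj Far τ hτ Φ hΦac.measurable hΦfar hΦnear ρ hρ hloc f hf C hC).symm
  obtain ⟨hAi, -⟩ := integral_mul_farAvg_comm Far _ hTi (fun _ => (1 : ℝ)) measurable_const 1 (fun _ => by simp)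
  exact RTAlgebra.IsRT.ae_eq hT hA hΦac.measurable hρ hTi hAi

/-- ★★★ **… IN PARTICULAR FOR THE AXIAL AVERAGE: `T^{axial}ρ =ᵐ A_Far(T^{axial}ρ)`** — the axially transported density of an integrable ρ not depending on the far-selected
bonds is a.e. a function of the near coarse variables only (file 35's `T^{axial}ρ = ∫ρ` is `Far = ⊤`). [cite: Balaban1985UV3, (10) p.258 (bookkeeping); Balaban1985Averaging, (15) p.19] -/
theorem rnTransport_axial_ae_eq_farAvg (hj : j + 1 ≤ P.m + P.K) (Far : PBond P (j + 1) → Prop) [DecidablePred Far] (τ : PBond P (j + 1) → ℕ)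
    (hτ : ∀ c, Far c → τ c < P.L) [DecidablePred fun b : PBond P j => ∃ c, Far c ∧ line c (τ c) = b]
    (ρ : Density P j G) (hρ : Integrable ρ (fieldMeasure P j G))
    (hloc : ∀ W W' : GaugeField P j G, (∀ b, (¬ ∃ c, Far c ∧ line c (τ c) = b) → W b = W' b) → ρ W = ρ W') :
    rnTransport (axialAvg : GaugeField P j G → GaugeField P (j + 1) G) ρ =ᵐ[fieldMeasure P (j + 1) G]
      fun V => ∫ v, rnTransport (axialAvg : GaugeField P j G → GaugeField P (j + 1) G) ρ
        ((FibreSplit.splitEquiv Far (P := P) (G := G)).symm ((FibreSplit.splitEquiv Far (P := P) (G := G) V).1, v))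
        ∂(Measure.pi fun _ : {c : PBond P (j + 1) // ¬¬ Far c} => (HaarData.haar : Measure G)) :=
  rnTransport_ae_eq_farAvg_of_coarseGraining hj Far τ hτ axialAvg (AvgAC.of_map_eq measurable_axialAvg (map_axialAvg hj)) (fun _ _ _ => rfl)
    (fun _ _ hUU' c hc => N08AxialDecimationFarFresh.axialAvg_congr_line c fun _ hs => hUU' _ fun ⟨c', hc', h⟩ =>
      hc ((line_inj hj (hτ c' hc') hs h).1 ▸ hc'))
    ρ hρ hloc

end AE

end Summit.QuantumFields.YangMills.BalabanUVNodes.N08AxialTransportFarIndependent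

end
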